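import Mathlib
import Literature.Analysis.OperatorTheory.HilbertBasisSchurTest
import Literature.Analysis.UnboundedOperators.DiagonalOperatorCompact
import Summits.NavierStokesRegularity.FluidComputer.BorderedEigenpairFromSections
import Summits.NavierStokesRegularity.FluidComputer.BorderedEigenpairFromSectionsCoord
import Summits.NavierStokesRegularity.FluidComputer.ResolventHeadTailBound

/-!
# THEOREM R (resolvent / non-resonance rows) FROM MATRIX DATA (diagonal / Hilbert-basis setting)
(profile-cert-3 g5, cell `ns-blowup`, 2026-08-26)

HONEST FRAMING (human rulings D-0035/D-0074): nothing here is a claim about Navier–Stokes blow-up.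
WHAT THIS IS NOT: not NS evidence. MODEL lane bookkeeping about the FORMAT of the F5 resolvent /
non-resonance certificates of GROUP B (`CertificateAbcResolvent*`, three implementations; Z4-a(2)
«CERTIFIED MODEL GERM» layer). `ResolventHeadTailBound.resolvent_inverse_of_head_tail` (p455708,
THEOREM R in resolvent coordinates) composed with the matrix dictionary of `BorderedEigenpairSections*`
(same seat), UNBORDERED version: `exists_headInverse_of_matrix` (a left inverse `Binv` of the GALERKIN
MATRIX `z − L_K` gives `Ainv`, `hAleft`); `head_alpha_bound` / `head_betaB_bound` / `head_betaC_bound`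
(the head constants from `‖Binv‖`, `‖Binv B_K‖` on the first outer shell, `‖C_K Binv‖`);
`tail_coercive_of_structure_complex` (tail coercivity for a COMPLEX anchor `z`; instab4's
`SkewCutGalerkinTailForm.tail_coercive_of_structure` is `z ∈ ℝ`); `resolvent_inverse_of_sections`
(END-TO-END, matrix inputs, `T` built by the Schur test ⇒ a two-sided inverse `Rinv` of `R_z` with
`‖S₀ Rinv‖ ≤ M₀` — the printed «`z ∉ σ(L|χ)`, `‖(z − L)⁻¹‖ ≤ M`»).

Mathlib + the files named; no new definitions. bears_on LADDER-NS N5 / Z4-a(2); evidence-only for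
`EpisodeBase` (stmt-NavierStokesRegularity-19179). [folklore] throughout.
-/

noncomputable section
namespace Summit.NavierStokesRegularity.FluidComputer.ResolventFromSections

open Filter Topology Submodule BorderedEigenpairSections BorderedEigenpairSectionsBand
  BorderedEigenpairFromSections
open scoped InnerProductSpace ComplexConjugate

variable {𝕜 H : Type*} [RCLike 𝕜] [NormedAddCommGroup H] [InnerProductSpace 𝕜 H] [CompleteSpace H]
variable {ι : Type*} (b : HilbertBasis ι 𝕜 H) [DecidableEq ι]

/-! ## §1 The head inverse from the inverse of the Galerkin matrix `z − L_K` -/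

/-- **Unbordered head inverse from the matrix inverse.** `S₀ = diag(d)`, `d_i (x₀ − ℓ_i) = 1`, head
`U_K`, `R = 1 − T − (x₀ − z) S₀`, `a_ij = ⟪b i, T b j⟫ (x₀ − ℓ_j)`: a linear left inverse `Binv` of
`c ↦ ((z − ℓ_i) c_i − Σ_{j∈K} a_ij c_j)_{i∈K}` yields `Ainv y = Σ_{j∈K} ((x₀ − ℓ_j)(Binv ŷ)_j) b_j`
(values in the head, `S₀ (Ainv y) = Σ_j (Binv ŷ)_j b_j`) with `Ainv (P (R u)) = u` on `U_K`. -/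
theorem exists_headInverse_of_matrix (ℓ : ι → ℝ) (x₀ : ℝ) (d : lp (fun _ : ι => 𝕜) ⊤)
    (hd : ∀ i, d i * ((x₀ : 𝕜) - (ℓ i : 𝕜)) = 1) (T : H →L[𝕜] H) (z : 𝕜) (K : Finset ι)
    (Binv : (K → 𝕜) →ₗ[𝕜] (K → 𝕜))
    (hBinv : ∀ c : K → 𝕜, Binv (fun i : K => (z - (ℓ i : 𝕜)) * c i -
      ∑ j : K, (⟪b i, T (b j)⟫_𝕜 * ((x₀ : 𝕜) - (ℓ j : 𝕜))) * c j) = c) :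
    ∃ Ainv : H →ₗ[𝕜] H,
      (∀ y : H, Ainv y = ∑ j : K, (((x₀ : 𝕜) - (ℓ j : 𝕜)) * Binv (fun i : K => ⟪b i, y⟫_𝕜) j) • b j) ∧
      (∀ y : H, Ainv y ∈ (span 𝕜 (b '' (K : Set ι))).topologicalClosure ∧
        b.diagonalCLM d (Ainv y) = ∑ j : K, Binv (fun i : K => ⟪b i, y⟫_𝕜) j • b j) ∧
      (∀ u ∈ (span 𝕜 (b '' (K : Set ι))).topologicalClosure,
        Ainv ((span 𝕜 (b '' (K : Set ι))).topologicalClosure.starProjection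
          (((1 : H →L[𝕜] H) - T - ((x₀ : 𝕜) - z) • b.diagonalCLM d) u)) = u) := by
  -- the bordered construction with a dummy border, restricted to the first component
  set U := (span 𝕜 (b '' (K : Set ι))).topologicalClosure with hU
  set S₀ := b.diagonalCLM d with hS₀
  let coords : H →ₗ[𝕜] (K → 𝕜) :=
    LinearMap.pi fun i : K => ((innerSL 𝕜 (b (i : ι)) : H →L[𝕜] 𝕜) : H →ₗ[𝕜] 𝕜)
  have hcoords : ∀ (y : H) (i : K), coords y i = ⟪b i, y⟫_𝕜 := fun y i => by
    simp [coords, LinearMap.pi_apply]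
  let synth : (K → 𝕜) →ₗ[𝕜] H :=
    { toFun := fun c => ∑ j : K, (((x₀ : 𝕜) - (ℓ j : 𝕜)) * c j) • b (j : ι)
      map_add' := fun c c' => by
        rw [← Finset.sum_add_distrib]
        exact Finset.sum_congr rfl fun j _ => by rw [Pi.add_apply, mul_add, add_smul]
      map_smul' := fun k c => by
        rw [RingHom.id_apply, Finset.smul_sum]
        exact Finset.sum_congr rfl fun j _ => by
          rw [Pi.smul_apply, smul_eq_mul, smul_smul, mul_left_comm] }
  let Ainv : H →ₗ[𝕜] H := synth ∘ₗ Binv ∘ₗ coords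
  have hAinv : ∀ y : H, Ainv y =
      ∑ j : K, (((x₀ : 𝕜) - (ℓ j : 𝕜)) * Binv (fun i : K => ⟪b i, y⟫_𝕜) j) • b (j : ι) := by
    intro y
    have hc : coords y = fun i : K => ⟪b i, y⟫_𝕜 := funext (hcoords y)
    simp only [Ainv, LinearMap.coe_comp, Function.comp_apply, hc]
    rfl
  have hext : ∀ (zv : K → 𝕜), ∑ j : K, (((x₀ : 𝕜) - (ℓ j : 𝕜)) * zv j) • b (j : ι) =
      ∑ j ∈ K, (((x₀ : 𝕜) - (ℓ j : 𝕜)) * (fun i : ι => if h : i ∈ K then zv ⟨i, h⟩ else 0) j) •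
        b j := by
    intro zv
    rw [← Finset.sum_coe_sort K]
    exact Finset.sum_congr rfl fun j _ => by simp only [dif_pos j.2]
  refine ⟨Ainv, hAinv, fun y => ?_, fun u hu => ?_⟩
  · rw [hAinv, hext]
    have h := headVector_mem_and_diag b ℓ x₀ d hd K
      (fun i : ι => if h : i ∈ K then Binv (fun i : K => ⟪b i, y⟫_𝕜) ⟨i, h⟩ else 0)
    refine ⟨h.1, ?_⟩
    rw [hS₀, h.2, ← Finset.sum_coe_sort K]
    exact Finset.sum_congr rfl fun j _ => by simp only [dif_pos j.2]
  · set c' : ι → 𝕜 := fun j => ⟪b j, S₀ u⟫_𝕜 with hc'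
    have huc : u = ∑ j ∈ K, (((x₀ : 𝕜) - (ℓ j : 𝕜)) * c' j) • b j :=
      eq_headVector_of_mem b ℓ x₀ d hd K hu
    have hfirst : (fun i : K => ⟪b i, U.starProjection
        (((1 : H →L[𝕜] H) - T - ((x₀ : 𝕜) - z) • S₀) u)⟫_𝕜) =
        fun i : K => (z - (ℓ i : 𝕜)) * c' i -
          ∑ j : K, (⟪b i, T (b j)⟫_𝕜 * ((x₀ : 𝕜) - (ℓ j : 𝕜))) * c' j := by
      funext i
      rw [inner_basis_starProjection, if_pos i.2]
      conv_lhs => rw [huc, hS₀]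
      rw [inner_basis_resolventCoord_headVector b ℓ x₀ d hd T z K c' i, if_pos i.2,
        ← Finset.sum_coe_sort K]
    rw [hAinv, hfirst, hBinv (fun j : K => c' j),
      Finset.sum_coe_sort K (fun j => (((x₀ : 𝕜) - (ℓ j : 𝕜)) * c' j) • b j), ← huc]

/-! ## §2 The three head constants from matrix norms -/
/-- `hαb` of p455708 from `‖Binv‖ ≤ α`. -/
theorem head_alpha_bound (S₀ : H →L[𝕜] H) (K : Finset ι) (Binv : (K → 𝕜) →ₗ[𝕜] (K → 𝕜))
    (Ainv : H →ₗ[𝕜] H)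
    (hA1 : ∀ y : H, S₀ (Ainv y) = ∑ j : K, Binv (fun i : K => ⟪b i, y⟫_𝕜) j • b j)
    {α : ℝ} (hα : 0 ≤ α)
    (hB : ∀ c : K → 𝕜, ∑ j : K, ‖Binv c j‖ ^ 2 ≤ α ^ 2 * ∑ i : K, ‖c i‖ ^ 2) :
    ∀ y ∈ (span 𝕜 (b '' (K : Set ι))).topologicalClosure, ‖S₀ (Ainv y)‖ ≤ α * ‖y‖ := by
  intro y hy
  have h2 : ‖S₀ (Ainv y)‖ ^ 2 ≤ (α * ‖y‖) ^ 2 := by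
    rw [hA1, norm_sq_sum_univ_smul_basis, mul_pow, ← sum_univ_norm_sq_inner_eq b K hy]
    exact hB _
  exact (pow_le_pow_iff_left₀ (norm_nonneg _) (by positivity) two_ne_zero).mp h2

/-- `hβBb` of p455708 from `‖Binv (−B_K ·)‖ ≤ β_B` on the first outer shell (`T` banded). -/
theorem head_betaB_bound (ℓ : ι → ℝ) (x₀ : ℝ) (d : lp (fun _ : ι => 𝕜) ⊤)
    (hd : ∀ i, d i * ((x₀ : 𝕜) - (ℓ i : 𝕜)) = 1) (T : H →L[𝕜] H) (z : 𝕜) (K : Finset ι)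
    (nbr : ι → Finset ι)
    (hTband : ∀ (i : ι) (x : H), ⟪b i, T x⟫_𝕜 = ∑ j ∈ nbr i, ⟪b i, T (b j)⟫_𝕜 * ⟪b j, x⟫_𝕜)
    (Binv : (K → 𝕜) →ₗ[𝕜] (K → 𝕜)) (Ainv : H →ₗ[𝕜] H)
    (hA1 : ∀ y : H, b.diagonalCLM d (Ainv y) = ∑ j : K, Binv (fun i : K => ⟪b i, y⟫_𝕜) j • b j)
    {βB : ℝ} (hβB : 0 ≤ βB)
    (hB : ∀ e : ι → 𝕜, ∑ j : K, ‖Binv (fun i : K => -∑ j ∈ nbr i \ K,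
        (⟪b i, T (b j)⟫_𝕜 * ((x₀ : 𝕜) - (ℓ j : 𝕜))) * e j) j‖ ^ 2 ≤
        βB ^ 2 * ∑ j ∈ K.biUnion nbr \ K, ‖e j‖ ^ 2) :
    ∀ w ∈ ((span 𝕜 (b '' (K : Set ι))).topologicalClosure)ᗮ,
      ‖b.diagonalCLM d (Ainv ((span 𝕜 (b '' (K : Set ι))).topologicalClosure.starProjection
          (((1 : H →L[𝕜] H) - T - ((x₀ : 𝕜) - z) • b.diagonalCLM d) w)))‖ ≤
        βB * ‖b.diagonalCLM d w‖ := by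
  intro w hw
  set U := (span 𝕜 (b '' (K : Set ι))).topologicalClosure with hU
  set S₀ := b.diagonalCLM d with hS₀
  set e : ι → 𝕜 := fun j => ⟪b j, S₀ w⟫_𝕜 with he
  have hSw : S₀ w ∈ Uᗮ := diagonalCLM_mem_orthogonal_closure_span b d K hw
  have hw0 : ∀ i ∈ K, ⟪b i, w⟫_𝕜 = 0 := (mem_orthogonal_closure_span_iff b K w).mp hw
  have hSw0 : ∀ i ∈ K, ⟪b i, S₀ w⟫_𝕜 = 0 := (mem_orthogonal_closure_span_iff b K _).mp hSw
  have hcoord : (fun i : K => ⟪b i, U.starProjection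
      (((1 : H →L[𝕜] H) - T - ((x₀ : 𝕜) - z) • S₀) w)⟫_𝕜) =
      fun i : K => -∑ j ∈ nbr i \ K, (⟪b i, T (b j)⟫_𝕜 * ((x₀ : 𝕜) - (ℓ j : 𝕜))) * e j := by
    funext i
    rw [inner_basis_starProjection, if_pos i.2]
    simp only [sub_apply, FunLike.coe_smul, Pi.smul_apply, one_apply_eq_self]
    rw [inner_sub_right, inner_sub_right, inner_smul_right, hw0 i i.2, hSw0 i i.2, mul_zero,
      sub_zero, zero_sub, neg_inj]
    have hB1 := congrFun (head_coord_T_tail b ℓ x₀ d hd T K nbr hTband hw) i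
    rw [inner_basis_starProjection, if_pos i.2] at hB1
    rw [hB1, he, hS₀]
  have h2 : ‖S₀ (Ainv (U.starProjection (((1 : H →L[𝕜] H) - T - ((x₀ : 𝕜) - z) • S₀) w)))‖ ^ 2 ≤
      (βB * ‖S₀ w‖) ^ 2 := by
    rw [hS₀, hA1, ← hS₀, norm_sq_sum_univ_smul_basis, hcoord, mul_pow]
    refine (hB e).trans (mul_le_mul_of_nonneg_left ?_ (sq_nonneg _))
    exact sum_norm_sq_inner_le b _ _
  exact (pow_le_pow_iff_left₀ (norm_nonneg _) (by positivity) two_ne_zero).mp h2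

/-- `hβCb` of p455708 from `‖C_K Binv‖ ≤ β_C` (leak of the head solution into the first outer shell;
`T` banded with symmetric band). -/
theorem head_betaC_bound (ℓ : ι → ℝ) (x₀ : ℝ) (d : lp (fun _ : ι => 𝕜) ⊤)
    (hd : ∀ i, d i * ((x₀ : 𝕜) - (ℓ i : 𝕜)) = 1) (T : H →L[𝕜] H) (z : 𝕜) (K : Finset ι)
    (nbr : ι → Finset ι) (hsymm : ∀ i j, j ∈ nbr i ↔ i ∈ nbr j)
    (hTband : ∀ (i : ι) (x : H), ⟪b i, T x⟫_𝕜 = ∑ j ∈ nbr i, ⟪b i, T (b j)⟫_𝕜 * ⟪b j, x⟫_𝕜)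
    (Binv : (K → 𝕜) →ₗ[𝕜] (K → 𝕜)) (Ainv : H →ₗ[𝕜] H)
    (hA0 : ∀ y : H, Ainv y =
      ∑ j : K, (((x₀ : 𝕜) - (ℓ j : 𝕜)) * Binv (fun i : K => ⟪b i, y⟫_𝕜) j) • b j)
    {βC : ℝ} (hβC : 0 ≤ βC)
    (hC : ∀ c : K → 𝕜, ∑ i ∈ K.biUnion nbr \ K,
      ‖∑ j : K, (⟪b i, T (b j)⟫_𝕜 * ((x₀ : 𝕜) - (ℓ j : 𝕜))) * Binv c j‖ ^ 2 ≤
        βC ^ 2 * ∑ i : K, ‖c i‖ ^ 2) :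
    ∀ y ∈ (span 𝕜 (b '' (K : Set ι))).topologicalClosure,
      ‖((1 : H →L[𝕜] H) - T - ((x₀ : 𝕜) - z) • b.diagonalCLM d) (Ainv y) -
          (span 𝕜 (b '' (K : Set ι))).topologicalClosure.starProjection
            (((1 : H →L[𝕜] H) - T - ((x₀ : 𝕜) - z) • b.diagonalCLM d) (Ainv y))‖ ≤ βC * ‖y‖ := by
  intro y hy
  set U := (span 𝕜 (b '' (K : Set ι))).topologicalClosure with hU
  set R : H →L[𝕜] H := (1 : H →L[𝕜] H) - T - ((x₀ : 𝕜) - z) • b.diagonalCLM d with hR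
  set zv : K → 𝕜 := Binv (fun i : K => ⟪b i, y⟫_𝕜) with hzv
  set z' : ι → 𝕜 := fun i => if h : i ∈ K then zv ⟨i, h⟩ else 0 with hz'
  set X : H := R (Ainv y) - U.starProjection (R (Ainv y)) with hX
  have hu' : Ainv y = ∑ j ∈ K, (((x₀ : 𝕜) - (ℓ j : 𝕜)) * z' j) • b j := by
    rw [hA0, ← Finset.sum_coe_sort K]
    exact Finset.sum_congr rfl fun j _ => by simp only [hz', dif_pos j.2, ← hzv, Subtype.coe_eta]
  have hsumK : ∀ i, ∑ j ∈ K, (⟪b i, T (b j)⟫_𝕜 * ((x₀ : 𝕜) - (ℓ j : 𝕜))) * z' j =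
      ∑ j : K, (⟪b i, T (b j)⟫_𝕜 * ((x₀ : 𝕜) - (ℓ j : 𝕜))) * zv j := fun i => by
    rw [← Finset.sum_coe_sort K]
    exact Finset.sum_congr rfl fun j _ => by simp only [hz', dif_pos j.2, Subtype.coe_eta]
  have hXi : ∀ i, ⟪b i, X⟫_𝕜 = if i ∈ K then 0 else
      -∑ j : K, (⟪b i, T (b j)⟫_𝕜 * ((x₀ : 𝕜) - (ℓ j : 𝕜))) * zv j := by
    intro i
    rw [hX, inner_sub_right, inner_basis_starProjection]
    split_ifs with hi
    · ring
    · rw [sub_zero, hu', hR, inner_basis_resolventCoord_headVector b ℓ x₀ d hd T z K z' i, if_neg hi,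
        zero_sub, hsumK]
  have hsupp : ∀ i, i ∉ K.biUnion nbr \ K → ⟪b i, X⟫_𝕜 = 0 := by
    intro i hi
    rw [hXi]
    split_ifs with hiK
    · rfl
    · have hi' : i ∉ K.biUnion nbr := fun h => hi (Finset.mem_sdiff.mpr ⟨h, hiK⟩)
      have ht : ∀ j : K, ⟪b i, T (b j)⟫_𝕜 = 0 := fun j => by
        refine matrix_eq_zero_of_not_mem_band b T nbr hTband fun hji => hi' ?_
        exact Finset.mem_biUnion.mpr ⟨j, j.2, (hsymm i j).mp hji⟩
      rw [neg_eq_zero]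
      exact Finset.sum_eq_zero fun j _ => by rw [ht j, zero_mul, zero_mul]
  have hnorm : ‖X‖ ^ 2 = ∑ i ∈ K.biUnion nbr \ K,
      ‖∑ j : K, (⟪b i, T (b j)⟫_𝕜 * ((x₀ : 𝕜) - (ℓ j : 𝕜))) * zv j‖ ^ 2 := by
    rw [norm_sq_eq_sum_of_support b _ hsupp]
    refine Finset.sum_congr rfl fun i hi => ?_
    rw [hXi, if_neg (Finset.mem_sdiff.mp hi).2, norm_neg]
  have h2 : ‖X‖ ^ 2 ≤ (βC * ‖y‖) ^ 2 := by
    rw [hnorm, mul_pow, ← sum_univ_norm_sq_inner_eq b K hy]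
    exact hC _
  exact (pow_le_pow_iff_left₀ (norm_nonneg _) (by positivity) two_ne_zero).mp h2

/-! ## §3 The tail coercivity for a complex anchor -/
omit [DecidableEq ι] in
/-- **Tail coercivity for a COMPLEX anchor `z`** (`SkewCutGalerkinTailForm.tail_coercive_of_structure`
is the case `z ∈ ℝ`): diagonal setting, `w ∈ Uᗮ` (`v = S₀ w ∈ Uᗮ`), every basis vector in `U` or `Uᗮ`,
`Ainv` linear with values in `U`; PAIRING bound `Re ⟪T w, v⟫ ≤ s‖v‖²`; certified SHELL inequality on
`sh` with the cross term `Re ⟪T (Ainv (P (T w))), v⟫`; TAIL CONSTANT `MU2 ≤ Re z − ℓ_i − s` off the head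
and the shell. Then `MU2 ‖v‖² ≤ Re ⟪R_z w − R_z (Ainv (P (R_z w))), v⟫`, `R_z = 1 − T − (x₀ − z) S₀` —
the `hcoer` of p455708. -/
theorem tail_coercive_of_structure_complex (ℓ : ι → ℝ) (x₀ : ℝ) (d : lp (fun _ : ι => 𝕜) ⊤)
    (hd : ∀ i, d i * ((x₀ : 𝕜) - (ℓ i : 𝕜)) = 1) (T : H →L[𝕜] H) (z : 𝕜) (U : Submodule 𝕜 H)
    [U.HasOrthogonalProjection] (hS₀U : ∀ y ∈ U, b.diagonalCLM d y ∈ U) (Ainv : H →ₗ[𝕜] H)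
    (hAinvU : ∀ y ∈ U, Ainv y ∈ U) {w : H} (hw : w ∈ Uᗮ) (hSw : b.diagonalCLM d w ∈ Uᗮ)
    (hhead : ∀ i, b i ∈ U ∨ b i ∈ Uᗮ) {s MU2 : ℝ} (sh : Finset ι)
    (hpair : RCLike.re ⟪T w, b.diagonalCLM d w⟫_𝕜 ≤ s * ‖b.diagonalCLM d w‖ ^ 2)
    (hshell : MU2 * ∑ i ∈ sh, ‖⟪b i, b.diagonalCLM d w⟫_𝕜‖ ^ 2 ≤
      ∑ i ∈ sh, (RCLike.re z - ℓ i - s) * ‖⟪b i, b.diagonalCLM d w⟫_𝕜‖ ^ 2 -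
        RCLike.re ⟪T (Ainv (U.starProjection (T w))), b.diagonalCLM d w⟫_𝕜)
    (htail : ∀ i, b i ∉ U → i ∉ sh → MU2 ≤ RCLike.re z - ℓ i - s) :
    MU2 * ‖b.diagonalCLM d w‖ ^ 2 ≤
      RCLike.re ⟪((1 : H →L[𝕜] H) - T - ((x₀ : 𝕜) - z) • b.diagonalCLM d) w -
        ((1 : H →L[𝕜] H) - T - ((x₀ : 𝕜) - z) • b.diagonalCLM d)
          (Ainv (U.starProjection (((1 : H →L[𝕜] H) - T - ((x₀ : 𝕜) - z) •
            b.diagonalCLM d) w))), b.diagonalCLM d w⟫_𝕜 := by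
  set S₀ : H →L[𝕜] H := b.diagonalCLM d with hS₀
  set v : H := S₀ w with hv
  set c : ι → ℝ := fun i => ‖⟪b i, v⟫_𝕜‖ ^ 2 with hc
  have hc0 : ∀ i, 0 ≤ c i := fun i => sq_nonneg _
  have hchead : ∀ i, b i ∈ U → c i = 0 := fun i hi => by
    simp only [hc]
    rw [inner_right_of_mem_orthogonal hi hSw, norm_zero]
    norm_num
  have hnorm : HasSum c (‖v‖ ^ 2) := BorderedEigenpairFromSectionsCoord.hasSum_norm_sq_coord b v
  have hdiag := hasSum_diagonal_pairing_re b ℓ x₀ d hd z w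
  rw [SkewCutGalerkinTailForm.schur_pairing_eq S₀ T (x₀ : 𝕜) z U hS₀U Ainv hAinvU hw hSw, map_sub,
    map_sub]
  set cross : ℝ := RCLike.re ⟪T (Ainv (U.starProjection (T w))), v⟫_𝕜 with hcross
  have hsum1 : HasSum (fun i => (RCLike.re z - ℓ i - s) * c i)
      (RCLike.re ⟪w - ((x₀ : 𝕜) - z) • v, v⟫_𝕜 - s * ‖v‖ ^ 2) := by
    have := hdiag.sub (hnorm.mul_left s)
    refine this.congr_fun fun i => ?_
    simp only [hc]; ring
  have hsplit1 := hsum1.summable.sum_add_tsum_compl (s := sh)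
  have hsplit2 := hnorm.summable.sum_add_tsum_compl (s := sh)
  rw [hsum1.tsum_eq] at hsplit1
  rw [hnorm.tsum_eq] at hsplit2
  have hcompl : MU2 * ∑' i : ↑((sh : Set ι)ᶜ), c i ≤
      ∑' i : ↑((sh : Set ι)ᶜ), (RCLike.re z - ℓ i - s) * c i := by
    rw [← tsum_mul_left]
    refine Summable.tsum_le_tsum (fun i => ?_) ((hnorm.summable.subtype _).mul_left MU2)
      (hsum1.summable.subtype _)
    obtain ⟨i, hi⟩ := i
    have hi' : i ∉ sh := by simpa using hi
    rcases hhead i with hU | hU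
    · simp [hchead i hU]
    · have hnot : b i ∉ U := fun hbU => by
        have := inner_left_of_mem_orthogonal hbU hU
        rw [inner_self_eq_zero] at this
        exact (b.orthonormal.ne_zero i) this
      exact mul_le_mul_of_nonneg_right (htail i hnot hi') (hc0 i)
  have hshell' : MU2 * ∑ i ∈ sh, c i ≤ ∑ i ∈ sh, (RCLike.re z - ℓ i - s) * c i - cross := hshell
  calc MU2 * ‖v‖ ^ 2 = MU2 * ∑ i ∈ sh, c i + MU2 * ∑' i : ↑((sh : Set ι)ᶜ), c i := by
        rw [← mul_add, hsplit2]
    _ ≤ (∑ i ∈ sh, (RCLike.re z - ℓ i - s) * c i - cross) +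
          ∑' i : ↑((sh : Set ι)ᶜ), (RCLike.re z - ℓ i - s) * c i := add_le_add hshell' hcompl
    _ = RCLike.re ⟪w - ((x₀ : 𝕜) - z) • v, v⟫_𝕜 - s * ‖v‖ ^ 2 - cross := by
        rw [← hsplit1]; ring
    _ ≤ RCLike.re ⟪w - ((x₀ : 𝕜) - z) • v, v⟫_𝕜 - RCLike.re ⟪T w, v⟫_𝕜 - cross := by
        linarith [hpair]

/-! ## §4 END-TO-END: THEOREM R from matrix data -/
/-- **THEOREM R from matrix data** (inputs as in the module docstring: resolvent symbol `d`, Schur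
matrix `t` with symmetric band, anchor `z`, left inverse `Binv` of the Galerkin matrix `z − L_K` with
matrix bounds `α, β_B, β_C`, shell inequality with `MU2 > 0` (cross term in coordinates), tail constant,
pairing bound for the Schur operator). CONCLUSION: `R_z = 1 − T − (x₀ − z) S₀` has a two-sided inverse
`Rinv` with `‖S₀ Rinv‖ ≤ M₀ = √((1 + β_C²)/MU2² + (α + β_B √(1 + β_C²)/MU2)²)`. -/
theorem resolvent_inverse_of_sections
    (ℓ : ι → ℝ) (x₀ : ℝ) (d : lp (fun _ : ι => 𝕜) ⊤) (hd : ∀ i, d i * ((x₀ : 𝕜) - (ℓ i : 𝕜)) = 1)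
    (hd0 : Tendsto (fun i => ‖d i‖) cofinite (𝓝 0))
    (t : ι → ι → 𝕜) {R₀ C₀ : ℝ} (hrow : ∀ i, Summable fun j => ‖t i j‖)
    (hR : ∀ i, ∑' j, ‖t i j‖ ≤ R₀) (hcol : ∀ j, Summable fun i => ‖t i j‖)
    (hC₀ : ∀ j, ∑' i, ‖t i j‖ ≤ C₀) (hR0 : 0 ≤ R₀) (hC0 : 0 ≤ C₀) (hq : R₀ * C₀ < 1)
    (nbr : ι → Finset ι) (hsymm : ∀ i j, j ∈ nbr i ↔ i ∈ nbr j)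
    (ht0 : ∀ i j, j ∉ nbr i → t i j = 0)
    (z : 𝕜) (K : Finset ι) (Binv : (K → 𝕜) →ₗ[𝕜] (K → 𝕜))
    (hBinv : ∀ c : K → 𝕜, Binv (fun i : K => (z - (ℓ i : 𝕜)) * c i -
      ∑ j : K, (t i j * ((x₀ : 𝕜) - (ℓ j : 𝕜))) * c j) = c)
    {α βB βC : ℝ} (hα : 0 ≤ α) (hβB : 0 ≤ βB) (hβC : 0 ≤ βC)
    (hαM : ∀ c : K → 𝕜, ∑ j : K, ‖Binv c j‖ ^ 2 ≤ α ^ 2 * ∑ i : K, ‖c i‖ ^ 2)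
    (hβBM : ∀ e : ι → 𝕜, ∑ j : K, ‖Binv (fun i : K => -∑ j ∈ nbr i \ K,
        (t i j * ((x₀ : 𝕜) - (ℓ j : 𝕜))) * e j) j‖ ^ 2 ≤
        βB ^ 2 * ∑ j ∈ K.biUnion nbr \ K, ‖e j‖ ^ 2)
    (hβCM : ∀ c : K → 𝕜, ∑ i ∈ K.biUnion nbr \ K,
      ‖∑ j : K, (t i j * ((x₀ : 𝕜) - (ℓ j : 𝕜))) * Binv c j‖ ^ 2 ≤ βC ^ 2 * ∑ i : K, ‖c i‖ ^ 2)
    {s MU2 : ℝ} (hMU2 : 0 < MU2) (sh : Finset ι)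
    (hshellM : ∀ e : ι → 𝕜, (∀ i ∈ K, e i = 0) →
      MU2 * ∑ i ∈ sh, ‖e i‖ ^ 2 ≤ ∑ i ∈ sh, (RCLike.re z - ℓ i - s) * ‖e i‖ ^ 2 -
        RCLike.re (∑ i ∈ K.biUnion nbr \ K,
          conj (∑ j : K, (t i j * ((x₀ : 𝕜) - (ℓ j : 𝕜))) *
            Binv (fun i : K => ∑ j ∈ nbr i \ K, (t i j * ((x₀ : 𝕜) - (ℓ j : 𝕜))) * e j) j) *
          e i))
    (htail : ∀ i, i ∉ K → i ∉ sh → MU2 ≤ RCLike.re z - ℓ i - s)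
    (hpair : ∀ T : H →L[𝕜] H, (∀ i j, ⟪b i, T (b j)⟫_𝕜 = t i j) →
      (∀ (i : ι) (x : H), ⟪b i, T x⟫_𝕜 = ∑ j ∈ nbr i, t i j * ⟪b j, x⟫_𝕜) →
      ∀ w ∈ ((span 𝕜 (b '' (K : Set ι))).topologicalClosure)ᗮ,
        RCLike.re ⟪T w, b.diagonalCLM d w⟫_𝕜 ≤ s * ‖b.diagonalCLM d w‖ ^ 2) :
    ∃ T : H →L[𝕜] H, (∀ i j, ⟪b i, T (b j)⟫_𝕜 = t i j) ∧ ‖T‖ ≤ Real.sqrt (R₀ * C₀) ∧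
    ∃ Rinv : H →L[𝕜] H,
      (∀ f, ((1 : H →L[𝕜] H) - T - ((x₀ : 𝕜) - z) • b.diagonalCLM d) (Rinv f) = f) ∧
      (∀ w, Rinv (((1 : H →L[𝕜] H) - T - ((x₀ : 𝕜) - z) • b.diagonalCLM d) w) = w) ∧
      ‖b.diagonalCLM d ∘L Rinv‖ ≤
        √((1 + βC ^ 2) / MU2 ^ 2 + (α + βB * √(1 + βC ^ 2) / MU2) ^ 2) ∧
      ∀ f, ‖b.diagonalCLM d (Rinv f)‖ ≤
        √((1 + βC ^ 2) / MU2 ^ 2 + (α + βB * √(1 + βC ^ 2) / MU2) ^ 2) * ‖f‖ := by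
  obtain ⟨T, hcoordT, -, hTt, hTn, -⟩ :=
    Literature.Analysis.OperatorTheory.HilbertBasisSchurTest.exists_clm_of_schur_bound b t hrow hR
      hcol hC₀ hR0 hC0
  have hT1 : ‖T‖ < 1 := by
    refine lt_of_le_of_lt hTn ?_
    rw [show (1 : ℝ) = Real.sqrt 1 from Real.sqrt_one.symm]
    exact Real.sqrt_lt_sqrt (mul_nonneg hR0 hC0) hq
  have hTu : IsUnit ((1 : H →L[𝕜] H) - T) := isUnit_one_sub_of_norm_lt_one hT1
  have hTband : ∀ (i : ι) (x : H), ⟪b i, T x⟫_𝕜 = ∑ j ∈ nbr i, ⟪b i, T (b j)⟫_𝕜 * ⟪b j, x⟫_𝕜 :=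
    band_formula_of_coord b T t hcoordT hTt nbr ht0
  have hTband' : ∀ (i : ι) (x : H), ⟪b i, T x⟫_𝕜 = ∑ j ∈ nbr i, t i j * ⟪b j, x⟫_𝕜 :=
    fun i x => by rw [hTband]; simp_rw [hTt]
  simp only [← hTt] at hBinv hβBM hβCM hshellM
  refine ⟨T, hTt, hTn, ?_⟩
  set S₀ : H →L[𝕜] H := b.diagonalCLM d with hS₀
  set U : Submodule 𝕜 H := (span 𝕜 (b '' (K : Set ι))).topologicalClosure with hU
  have hS₀c : IsCompactOperator S₀ := b.isCompactOperator_diagonalCLM_of_tendsto_zero d hd0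
  have hS₀inj : Function.Injective S₀ := (injective_iff_map_eq_zero _).mpr
    (SkewCutGalerkinTailForm.diagonalCLM_injective_of_resolvent b ℓ x₀ d hd)
  have hS₀U : ∀ u ∈ U, S₀ u ∈ U := fun u hu =>
    SkewCutGalerkinPerturbation.diagonalCLM_mem_closure_span b d (K : Set ι) hu
  have hS₀U' : ∀ w ∈ Uᗮ, S₀ w ∈ Uᗮ := fun w hw => diagonalCLM_mem_orthogonal_closure_span b d K hw
  obtain ⟨Ainv, hA0, hAhead, hAleft⟩ := exists_headInverse_of_matrix b ℓ x₀ d hd T z K Binv hBinv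
  have hA1 : ∀ y : H, S₀ (Ainv y) = ∑ j : K, Binv (fun i : K => ⟪b i, y⟫_𝕜) j • b j :=
    fun y => (hAhead y).2
  have hAinvU : ∀ y ∈ U, Ainv y ∈ U := fun y _ => (hAhead y).1
  have hαb := head_alpha_bound b S₀ K Binv Ainv hA1 hα hαM
  have hβBb := head_betaB_bound b ℓ x₀ d hd T z K nbr hTband Binv Ainv hA1 hβB hβBM
  have hβCb := head_betaC_bound b ℓ x₀ d hd T z K nbr hsymm hTband Binv Ainv hA0 hβC hβCM
  have hcoer : ∀ w ∈ Uᗮ, MU2 * ‖S₀ w‖ ^ 2 ≤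
      RCLike.re ⟪((1 : H →L[𝕜] H) - T - ((x₀ : 𝕜) - z) • S₀) w -
        ((1 : H →L[𝕜] H) - T - ((x₀ : 𝕜) - z) • S₀)
          (Ainv (U.starProjection (((1 : H →L[𝕜] H) - T - ((x₀ : 𝕜) - z) • S₀) w))),
        S₀ w⟫_𝕜 := by
    intro w hw
    have hSw : S₀ w ∈ Uᗮ := hS₀U' w hw
    set e : ι → 𝕜 := fun i => ⟪b i, S₀ w⟫_𝕜 with he
    have he0 : ∀ i ∈ K, e i = 0 := (mem_orthogonal_closure_span_iff b K _).mp hSw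
    have hB1 := head_coord_T_tail b ℓ x₀ d hd T K nbr hTband hw
    set zv : K → 𝕜 := Binv (fun i : K => ∑ j ∈ nbr i \ K,
      (⟪b i, T (b j)⟫_𝕜 * ((x₀ : 𝕜) - (ℓ j : 𝕜))) * e j) with hzv
    have ha1 : Ainv (U.starProjection (T w)) =
        ∑ j : K, (((x₀ : 𝕜) - (ℓ j : 𝕜)) * zv j) • b (j : ι) := by
      rw [hA0, hB1]
    have hcross : ⟪T (Ainv (U.starProjection (T w))), S₀ w⟫_𝕜 =
        ∑ i ∈ K.biUnion nbr \ K, conj (∑ j : K, (⟪b i, T (b j)⟫_𝕜 * ((x₀ : 𝕜) - (ℓ j : 𝕜))) *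
          zv j) * e i := by
      rw [ha1]
      exact cross_eq_sum b S₀ T ℓ x₀ K nbr hsymm hTband zv hSw
    have hshell : MU2 * ∑ i ∈ sh, ‖⟪b i, S₀ w⟫_𝕜‖ ^ 2 ≤
        ∑ i ∈ sh, (RCLike.re z - ℓ i - s) * ‖⟪b i, S₀ w⟫_𝕜‖ ^ 2 -
          RCLike.re ⟪T (Ainv (U.starProjection (T w))), S₀ w⟫_𝕜 := by
      rw [hcross]
      exact hshellM e he0
    exact tail_coercive_of_structure_complex b ℓ x₀ d hd T z U hS₀U Ainv hAinvU hw hSw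
      (basis_mem_or_mem_orthogonal b K) sh (hpair T hTt hTband' w hw) hshell
      (fun i hi hi' => htail i (fun h => hi ((span 𝕜 (b '' (K : Set ι))).le_topologicalClosure
        (subset_span ⟨i, h, rfl⟩))) hi')
  exact ResolventHeadTailBound.resolvent_inverse_of_head_tail S₀ T hS₀c hS₀inj hTu ((x₀ : 𝕜) - z) U
    hS₀U hS₀U' Ainv hAleft hMU2 hα hβB hβC hαb hβBb hβCb hcoer

end Summit.NavierStokesRegularity.FluidComputer.ResolventFromSections

end
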